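import Literature.FieldTheory.FunctionField.RationalLurothLattice
import Literature.FieldTheory.FunctionField.RationalAutomorphismsMoebius
import Mathlib.FieldTheory.Galois.Basic
import Mathlib.GroupTheory.Perm.Cycle.Type
import Mathlib.GroupTheory.SpecificGroups.Cyclic
import HarnessLib

/-!
# The fixing group `G(f) ≤ Aut_K K(u)` of a rational function and the fixed field of a finite group of Möbius
# transformations: `Fix(H) = K(f)` with `deg f = |H|` (Artin + Lüroth), `|G(f)| ∣ deg f`, `|G(f)| = deg f ⟺ K(u)/K(f)`
# Galois, and `G(f)` of an indecomposable `f` (Gutierrez–Sevilla §3, Thms 6–8, Cor. 1)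

Topic `Literature/FieldTheory/FunctionField`; namespace `Literature.FieldTheory.FunctionField`.  Lane
`lit-hodgefound` (Track 2 foundations library), seat p01 gen 26, row g26-#3.  THEOREMS ONLY (no definition, no
named fact, no instance, no notation; D-0014/D-0026, net Literature debt 0).  Sequel BY IMPORT of g26-#1
`RationalLurothLattice` (`isCoatom_adjoin_iff`, `adjoin_eq_top_iff_max_natDegree_eq_one`, `max_natDegree_ne_zero_of_ne_C`,
finiteness), Mathlib's LÜROTH (`RatFunc.Luroth.eq_adjoin_generator`), ARTIN
(`FixedPoints.finrank_eq_card`: `[E : E^H] = |H|`; `IsGalois.of_fixed_field`), the Galois-theory dictionary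
`IntermediateField.fixedField` / `IntermediateField.fixingSubgroup` / `le_iff_le` / `fixingSubgroupEquiv`,
`IsGalois.card_aut_eq_finrank`, Cauchy's theorem `exists_prime_orderOf_dvd_card'` — REUSED, nothing restated.
NOTE: Mathlib states `finrank_fixedField_eq_card` and `fixingSubgroup_fixedField` only under `[FiniteDimensional F E]`,
which FAILS for `K(u)/K`; §2 re-derives them for a FINITE subgroup `H ≤ Aut_K K(u)` from Artin's theorem directly.

## Sources, VERBATIM

J. Gutierrez, D. Sevilla, *Building counterexamples to generalizations for rational functions of Ritt's decomposition
theorem*, J. Algebra 303 (2006) = arXiv:0804.1687 [GutierrezSevilla2008] (held `paper:arxiv-0804.1687`, p0005):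
§3 «Let `Γ(K) = Aut_K K(x)` […] The elements of `Γ(K)` can be identified with the images of `x` under the
automorphisms, that is, with Möbius transformations»; **Definition 4** «(i) Let `f ∈ K(x)`. We define
`G(f) = {u ∈ Γ(K) : f ∘ u = f}`. (ii) Let `H < Γ(K)`. We define `Fix(H) = {f ∈ K(x) : f ∘ u = f ∀ u ∈ H}`.»;
Remark 2 «As `K(f) = K(f′)` if and only if `f = u ∘ f′` for some unit `u`, we have that the application `K(f) ↦ G(f)`
is well-defined.»; **Theorem 6** «Let `H` be a subgroup of `Γ`. (i) `H` is infinite ⇒ `Fix(H) = K`. (ii) `H` is finite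
⇒ `K ⊊ Fix(H)`, `Fix(H) ⊂ K(x)` is a normal extension, and in particular `Fix(H) = K(f)` with `deg f = |H|`.»;
**Theorem 7** «(i) For any non-constant `f ∈ K(x)`, `|G(f)|` divides `deg f`. […] (ii) If `|G(f)| = deg f` then
`K(f) ⊆ K(x)` is normal. Moreover, if the extension `K(f) ⊆ K(x)` is separable, then `K(f) ⊆ K(x)` is normal ⇒
`|G(f)| = deg f`. (iii) Given a finite subgroup `H` of `Γ`, there is a bijection between the subgroups of `H` and the
fields between `Fix(H)` and `K(x)`.»  Proof of (i): «The field `Fix(G(f))` is between `K(f)` and `K(x)`, therefore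
the degree of any generator, which is the same as `|G(f)|`, divides `deg f`.»; **Theorem 8** «Let `f` be
indecomposable. (i) If `deg f` is prime, then either `G(f)` is cyclic of order `deg f`, or it is trivial. (ii) If
`deg f` is composite, then `G(f)` is trivial.»; **Corollary 1** «If `f` has composite degree and `G(f)` is not
trivial, `f` is decomposable.»; **Remark 3** «`K(x)` is Galois over `K` (that is, the only rational functions
fixed by `Γ(K)` are the constant ones) if and only if `K` is infinite. Indeed, if `K` is infinite, for each non-constant
function `f` there exists a unit `x + b` with `b ∈ K` which does not leave it fixed. On the other hand, if `K` is finite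
then `Γ(K)` is finite too, an[d] the proof of Theorem 6 provides a non-constant rational function that generates
`Fix(Γ(K))`.»

## Dictionary

`Γ = RatFunc K ≃ₐ[K] RatFunc K`; `G(f) = (K(f)).fixingSubgroup ≤ Γ` (§1: `σ ∈ G(f) ⟺ σ f = f`, i.e. `f ∘ σ(u) = f`);
`Fix(H) = IntermediateField.fixedField H`; «normal» for the finite extension `K(u)/Fix(H)` = `IsGalois` (Artin's
theorem gives separable AND normal); `deg f = max(deg num f, deg denom f) = [K(u) : K(f)]`; «indecomposable» =
`IsCoatom K(f)` (g26-#1 `isCoatom_adjoin_iff`).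

## What is proved (`K` ANY field)

* §1 `mem_fixingSubgroup_adjoin_iff` (Def. 4: `σ ∈ G(f) ⟺ σ f = f`), `fixingSubgroup_adjoin_eq_stabilizer`.
* §2 (Thm 6 (ii), ARTIN + LÜROTH for a FINITE `H ≤ Γ`) **`finrank_fixedField_eq_card_of_finite`**
  (`[K(u) : Fix(H)] = |H|`), `finiteDimensional_fixedField_of_finite`, **`isGalois_fixedField_of_finite`** (normal and
  separable), `fixedField_ne_bot_of_finite` (`K ⊊ Fix(H)`), **`exists_fixedField_eq_adjoin`** (`Fix(H) = K(f)` with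
  `deg f = |H|`), **`fixingSubgroup_fixedField_of_finite`** (`G(Fix H) = H`: `H` is the fixing group of its invariant
  function `f`).
* §3 (Thm 6 (i)) `finite_fixingSubgroup_adjoin` (`G(f)` is finite for `f` non-constant),
  **`fixedField_eq_bot_of_infinite`** (`H` infinite ⟹ `Fix(H) = K`).
* §4 (Thm 7) **`card_fixingSubgroup_adjoin_dvd`** (`|G(f)| ∣ deg f`), `card_fixingSubgroup_adjoin_le`,
  **`card_fixingSubgroup_adjoin_eq_iff_isGalois`** (`|G(f)| = deg f ⟺ K(u)/K(f)` Galois — (ii) in both directions,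
  the separability proviso being part of `IsGalois`), `fixedField_fixingSubgroup_adjoin_of_card_eq`
  (`|G(f)| = deg f ⟹ Fix(G(f)) = K(f)`); (iii) **`fixingSubgroup_fixedField_of_le`** / **`fixedField_fixingSubgroup_of_le`**
  (for `H` finite, `H′ ↦ Fix(H′)` and `M ↦ G(M)` are inverse bijections between the subgroups of `H` and the fields
  above `Fix(H)`).
* §5 (Thm 8, Cor. 1) **`card_fixingSubgroup_adjoin_of_isCoatom`** (`f` indecomposable ⟹ `|G(f)| = 1 ∨ |G(f)| = deg f`),
  **`card_fixingSubgroup_adjoin_eq_one_of_isCoatom_of_not_prime`** ((ii): composite degree ⟹ `G(f)` trivial, by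
  Cauchy: a subgroup of prime order `p < deg f` would cut out a proper intermediate field),
  **`isCyclic_fixingSubgroup_adjoin_of_isCoatom_of_prime`** ((i)), **`not_isCoatom_of_card_fixingSubgroup_ne_one`**
  (Cor. 1).

* §6 (Remark 3) `ringHom_ratFunc_ext`, `algEquiv_ext_of_apply_X_eq`, `injective_algEquiv_apply_X` (`σ ↦ σ(u)` is
  injective), `exists_injective_translation` (`K ↪ Γ(K)`, `b ↦ (u ↦ u + b)`), `infinite_algEquiv_of_infinite`,
  **`fixedField_top_eq_bot_of_infinite`** (`K` infinite ⟹ `Fix(Γ) = K`), `finite_algEquiv_of_finite` (`K` finite ⟹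
  `Γ(K)` finite), **`fixedField_top_ne_bot_of_finite`** (`K` finite ⟹ `Fix(Γ) = K(f) ⊋ K`, `deg f = |Γ(K)|`),
  **`fixedField_top_eq_bot_iff_infinite`**.

## Honest scope

The second clause of Thm 7 (i) (a function with `1 < |G(f)| < deg f` exists over every field, e.g. `x²(x−1)²`) is not
formalised; `|Γ(F_q)| = q³ − q` and the Dickson-invariant generator of `Fix(Γ(F_q))` are not computed.
-/

noncomputable section

open Polynomial IntermediateField

namespace Literature.FieldTheory.FunctionField

variable {K : Type*} [Field K]

/-! ### §1. `G(f)` is the fixing subgroup of `K(f)` -/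

/-- **Definition 4 as a theorem: `σ ∈ G(f) = FixingSubgroup(K(f))` iff `σ f = f`** (a `K`-automorphism fixes `K(f)`
pointwise iff it fixes `f`). [cite: GutierrezSevilla2008, §3 Def. 4] -/
theorem mem_fixingSubgroup_adjoin_iff (f : RatFunc K) (σ : RatFunc K ≃ₐ[K] RatFunc K) :
    σ ∈ (IntermediateField.adjoin K ({f} : Set (RatFunc K))).fixingSubgroup ↔ σ f = f := by
  constructor
  · intro h
    exact (IntermediateField.mem_fixingSubgroup_iff _ _).mp h f (mem_adjoin_simple_self K f)
  · intro h
    rw [← Subgroup.zpowers_le, ← IntermediateField.le_iff_le, adjoin_simple_le_iff,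
      IntermediateField.mem_fixedField_iff]
    intro g hg
    have hst : Subgroup.zpowers σ ≤ MulAction.stabilizer (RatFunc K ≃ₐ[K] RatFunc K) f := by
      rw [Subgroup.zpowers_le, MulAction.mem_stabilizer_iff, AlgEquiv.smul_def]
      exact h
    have hg' := hst hg
    rw [MulAction.mem_stabilizer_iff, AlgEquiv.smul_def] at hg'
    exact hg'

/-- `G(f)` is the stabiliser of `f` under `Γ = Aut_K K(u)`. [cite: GutierrezSevilla2008, §3 Def. 4] -/
theorem fixingSubgroup_adjoin_eq_stabilizer (f : RatFunc K) :
    (IntermediateField.adjoin K ({f} : Set (RatFunc K))).fixingSubgroup =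
      MulAction.stabilizer (RatFunc K ≃ₐ[K] RatFunc K) f := by
  ext σ
  rw [mem_fixingSubgroup_adjoin_iff, MulAction.mem_stabilizer_iff, AlgEquiv.smul_def]

/-- `G(f)` depends only on the field `K(f)` (Remark 2: `K(f) = K(f′)` ⟹ `G(f) = G(f′)`). [cite: GutierrezSevilla2008, §3 Remark 2] -/
theorem fixingSubgroup_adjoin_eq_of_adjoin_eq {f f' : RatFunc K}
    (h : IntermediateField.adjoin K ({f} : Set (RatFunc K)) = IntermediateField.adjoin K ({f'} : Set (RatFunc K))) :
    MulAction.stabilizer (RatFunc K ≃ₐ[K] RatFunc K) f = MulAction.stabilizer (RatFunc K ≃ₐ[K] RatFunc K) f' := by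
  rw [← fixingSubgroup_adjoin_eq_stabilizer, ← fixingSubgroup_adjoin_eq_stabilizer, h]

/-! ### §2. Theorem 6 (ii): the fixed field of a FINITE group of Möbius transformations -/

section FiniteGroup

variable (H : Subgroup (RatFunc K ≃ₐ[K] RatFunc K)) [Finite H]

/-- **Artin for `K(u)`: `[K(u) : Fix(H)] = |H|`** for a finite `H ≤ Aut_K K(u)` (no finite-dimensionality of `K(u)/K`
is needed). [cite: GutierrezSevilla2008, §3 Thm 6 (ii)] -/
theorem finrank_fixedField_eq_card_of_finite :
    Module.finrank (IntermediateField.fixedField H) (RatFunc K) = Nat.card H := by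
  have := Fintype.ofFinite H
  rw [Nat.card_eq_fintype_card]
  exact FixedPoints.finrank_eq_card H (RatFunc K)

/-- `K(u)/Fix(H)` is finite. [cite: GutierrezSevilla2008, §3 Thm 6 (ii)] -/
theorem finiteDimensional_fixedField_of_finite :
    FiniteDimensional (IntermediateField.fixedField H) (RatFunc K) :=
  Module.finite_of_finrank_pos (by rw [finrank_fixedField_eq_card_of_finite]; exact Nat.card_pos)

/-- **`K(u)/Fix(H)` is Galois (normal and separable).** [cite: GutierrezSevilla2008, §3 Thm 6 (ii)] -/
theorem isGalois_fixedField_of_finite : IsGalois (IntermediateField.fixedField H) (RatFunc K) :=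
  IsGalois.of_fixed_field (RatFunc K) H

omit [Finite H] in
/-- `[K(u) : K] = ∞`, recorded as `finrank = 0` (`K = K(0)` and `deg 0 = 0`). [cite: GutierrezSevilla2008, §3 Thm 6 (ii)] -/
theorem finrank_bot_ratFunc_eq_zero : Module.finrank (⊥ : IntermediateField K (RatFunc K)) (RatFunc K) = 0 := by
  have h0 := RatFunc.finrank_eq_max_natDegree (0 : RatFunc K)
  rwa [IntermediateField.adjoin_zero, RatFunc.num_zero, RatFunc.denom_zero, natDegree_zero, natDegree_one,
    max_self] at h0

/-- **`K ⊊ Fix(H)`** (`[K(u) : K] = ∞` while `[K(u) : Fix(H)] = |H| < ∞`). [cite: GutierrezSevilla2008, §3 Thm 6 (ii)] -/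
theorem fixedField_ne_bot_of_finite : IntermediateField.fixedField H ≠ ⊥ := by
  intro h
  have hc := finrank_fixedField_eq_card_of_finite H
  rw [h, finrank_bot_ratFunc_eq_zero] at hc
  exact Nat.card_pos.ne' hc.symm

/-- **THEOREM 6 (ii): `Fix(H) = K(f)` for a non-constant `f` with `deg f = |H|`** (Lüroth gives the generator, Artin the
degree). [cite: GutierrezSevilla2008, §3 Thm 6 (ii)] -/
theorem exists_fixedField_eq_adjoin :
    ∃ f : RatFunc K, (¬ ∃ c, f = RatFunc.C c) ∧
      IntermediateField.fixedField H = IntermediateField.adjoin K ({f} : Set (RatFunc K)) ∧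
        max f.num.natDegree f.denom.natDegree = Nat.card H := by
  have hne := fixedField_ne_bot_of_finite H
  refine ⟨RatFunc.Luroth.generator (IntermediateField.fixedField H), RatFunc.Luroth.generator_ne_C hne,
    RatFunc.Luroth.eq_adjoin_generator, ?_⟩
  rw [← RatFunc.finrank_eq_max_natDegree, ← RatFunc.Luroth.eq_adjoin_generator]
  exact finrank_fixedField_eq_card_of_finite H

/-- `G(Fix H)` is finite (it is `Gal(K(u)/Fix(H))`). [cite: GutierrezSevilla2008, §3 Thm 6 (ii), Thm 7 (iii)] -/
theorem finite_fixingSubgroup_fixedField : Finite (IntermediateField.fixedField H).fixingSubgroup := by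
  haveI := finiteDimensional_fixedField_of_finite H
  exact Finite.of_equiv _ (fixingSubgroupEquiv (IntermediateField.fixedField H)).toEquiv.symm

/-- **`G(Fix(H)) = H`: a finite group of `K`-automorphisms is exactly the fixing group of its fixed field** (so, with
`Fix(H) = K(f)`: `H = G(f)`). [cite: GutierrezSevilla2008, §3 Thm 6 (ii), Thm 7 (iii)] -/
theorem fixingSubgroup_fixedField_of_finite :
    (IntermediateField.fixedField H).fixingSubgroup = H := by
  have H_le : H ≤ (IntermediateField.fixedField H).fixingSubgroup := (IntermediateField.le_iff_le _ _).mp le_rfl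
  classical
  haveI := finiteDimensional_fixedField_of_finite H
  haveI := finite_fixingSubgroup_fixedField H
  suffices Nat.card H = Nat.card (IntermediateField.fixedField H).fixingSubgroup by
    exact SetLike.coe_injective (Set.eq_of_inclusion_surjective
      ((Nat.bijective_iff_injective_and_card (Set.inclusion H_le)).mpr
        ⟨Set.inclusion_injective H_le, this⟩).2).symm
  apply Nat.card_congr
  refine (FixedPoints.toAlgHomEquiv H (RatFunc K)).trans ?_
  refine (algEquivEquivAlgHom (IntermediateField.fixedField H) (RatFunc K)).toEquiv.symm.trans ?_
  exact (fixingSubgroupEquiv (IntermediateField.fixedField H)).toEquiv.symm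

end FiniteGroup

/-! ### §3. Theorem 6 (i): an infinite group fixes only the constants -/

/-- `K(u)/K(f)` is finite for `f` non-constant (`[K(u) : K(f)] = deg f`). [cite: GutierrezSevilla2008, Def. 1, §3 Thm 7 (i)] -/
theorem finiteDimensional_adjoin_of_ne_C {f : RatFunc K} (hf : ¬ ∃ c, f = RatFunc.C c) :
    FiniteDimensional (IntermediateField.adjoin K ({f} : Set (RatFunc K))) (RatFunc K) :=
  Module.finite_of_finrank_pos (by
    rw [RatFunc.finrank_eq_max_natDegree]
    exact Nat.pos_of_ne_zero (max_natDegree_ne_zero_of_ne_C hf))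

/-- **`G(f)` is finite** for `f` non-constant (`G(f) ≅ Gal(K(u)/K(f))`, `[K(u) : K(f)] = deg f < ∞`).
[cite: GutierrezSevilla2008, §3 Thm 7 (i)] -/
theorem finite_fixingSubgroup_adjoin {f : RatFunc K} (hf : ¬ ∃ c, f = RatFunc.C c) :
    Finite (IntermediateField.adjoin K ({f} : Set (RatFunc K))).fixingSubgroup := by
  haveI := finiteDimensional_adjoin_of_ne_C hf
  exact Finite.of_equiv _ (fixingSubgroupEquiv (IntermediateField.adjoin K ({f} : Set (RatFunc K)))).toEquiv.symm

/-- **THEOREM 6 (i): an infinite `H ≤ Aut_K K(u)` has `Fix(H) = K`** («no non-constant function can be fixed by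
infinitely many units»: `H ≤ G(f)` and `G(f)` is finite). [cite: GutierrezSevilla2008, §3 Thm 6 (i)] -/
theorem fixedField_eq_bot_of_infinite (H : Subgroup (RatFunc K ≃ₐ[K] RatFunc K)) (hH : ¬ Finite H) :
    IntermediateField.fixedField H = ⊥ := by
  by_contra hne
  have hgen := RatFunc.Luroth.generator_ne_C hne
  have hle : H ≤ (IntermediateField.fixedField H).fixingSubgroup := (IntermediateField.le_iff_le _ _).mp le_rfl
  rw [RatFunc.Luroth.eq_adjoin_generator (E := IntermediateField.fixedField H)] at hle
  haveI := finite_fixingSubgroup_adjoin hgen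
  exact hH (Finite.of_injective _ (Subgroup.inclusion_injective hle))

/-! ### §4. Theorem 7: `|G(f)| ∣ deg f`; equality iff `K(u)/K(f)` is Galois; the correspondence above `Fix(H)` -/

section Gf

variable {f : RatFunc K} (hf : ¬ ∃ c, f = RatFunc.C c)
include hf

/-- **THEOREM 7 (i): `|G(f)|` divides `deg f`** («The field `Fix(G(f))` is between `K(f)` and `K(x)`, therefore the
degree of any generator, which is the same as `|G(f)|`, divides `deg f`»). [cite: GutierrezSevilla2008, §3 Thm 7 (i)] -/
theorem card_fixingSubgroup_adjoin_dvd :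
    Nat.card (IntermediateField.adjoin K ({f} : Set (RatFunc K))).fixingSubgroup ∣
      max f.num.natDegree f.denom.natDegree := by
  haveI := finite_fixingSubgroup_adjoin hf
  have hle : IntermediateField.adjoin K ({f} : Set (RatFunc K)) ≤
      IntermediateField.fixedField (IntermediateField.adjoin K ({f} : Set (RatFunc K))).fixingSubgroup :=
    (IntermediateField.le_iff_le _ _).mpr le_rfl
  have h := relfinrank_mul_finrank_top hle
  rw [finrank_fixedField_eq_card_of_finite, RatFunc.finrank_eq_max_natDegree] at h
  exact Dvd.intro_left _ h

/-- Hence `|G(f)| ≤ deg f`. [cite: GutierrezSevilla2008, §3 Thm 7 (i)] -/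
theorem card_fixingSubgroup_adjoin_le :
    Nat.card (IntermediateField.adjoin K ({f} : Set (RatFunc K))).fixingSubgroup ≤
      max f.num.natDegree f.denom.natDegree :=
  Nat.le_of_dvd (Nat.pos_of_ne_zero (max_natDegree_ne_zero_of_ne_C hf)) (card_fixingSubgroup_adjoin_dvd hf)

/-- **THEOREM 7 (ii): `|G(f)| = deg f` iff `K(u)/K(f)` is Galois** (`⟹`: then `Fix(G(f)) = K(f)` by degrees and
`K(u)/Fix` is Galois by Artin; `⟸`: `|Gal| = [K(u) : K(f)]`). [cite: GutierrezSevilla2008, §3 Thm 7 (ii)] -/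
theorem card_fixingSubgroup_adjoin_eq_iff_isGalois :
    Nat.card (IntermediateField.adjoin K ({f} : Set (RatFunc K))).fixingSubgroup =
        max f.num.natDegree f.denom.natDegree ↔
      IsGalois (IntermediateField.adjoin K ({f} : Set (RatFunc K))) (RatFunc K) := by
  haveI := finite_fixingSubgroup_adjoin hf
  haveI := finiteDimensional_adjoin_of_ne_C hf
  constructor
  · intro hcard
    have hle : IntermediateField.adjoin K ({f} : Set (RatFunc K)) ≤
        IntermediateField.fixedField (IntermediateField.adjoin K ({f} : Set (RatFunc K))).fixingSubgroup :=
      (IntermediateField.le_iff_le _ _).mpr le_rfl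
    have heq : IntermediateField.adjoin K ({f} : Set (RatFunc K)) =
        IntermediateField.fixedField (IntermediateField.adjoin K ({f} : Set (RatFunc K))).fixingSubgroup :=
      eq_of_le_of_finrank_eq' hle
        (by rw [finrank_fixedField_eq_card_of_finite, RatFunc.finrank_eq_max_natDegree, hcard])
    rw [heq]
    exact isGalois_fixedField_of_finite _
  · intro hgal
    rw [← RatFunc.finrank_eq_max_natDegree, ← IsGalois.card_aut_eq_finrank]
    exact Nat.card_congr (fixingSubgroupEquiv (IntermediateField.adjoin K ({f} : Set (RatFunc K)))).toEquiv

/-- If `|G(f)| = deg f` then `Fix(G(f)) = K(f)`. [cite: GutierrezSevilla2008, §3 Thm 7 (ii)] -/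
theorem fixedField_fixingSubgroup_adjoin_of_card_eq
    (hcard : Nat.card (IntermediateField.adjoin K ({f} : Set (RatFunc K))).fixingSubgroup =
      max f.num.natDegree f.denom.natDegree) :
    IntermediateField.fixedField (IntermediateField.adjoin K ({f} : Set (RatFunc K))).fixingSubgroup =
      IntermediateField.adjoin K ({f} : Set (RatFunc K)) := by
  haveI := finite_fixingSubgroup_adjoin hf
  haveI := finiteDimensional_adjoin_of_ne_C hf
  have hle : IntermediateField.adjoin K ({f} : Set (RatFunc K)) ≤
      IntermediateField.fixedField (IntermediateField.adjoin K ({f} : Set (RatFunc K))).fixingSubgroup :=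
    (IntermediateField.le_iff_le _ _).mpr le_rfl
  exact (eq_of_le_of_finrank_eq' hle
    (by rw [finrank_fixedField_eq_card_of_finite, RatFunc.finrank_eq_max_natDegree, hcard])).symm

end Gf

section Correspondence

variable (H : Subgroup (RatFunc K ≃ₐ[K] RatFunc K)) [Finite H]

/-- **THEOREM 7 (iii), subgroups ↦ fields: for `H′ ≤ H` (finite), `G(Fix(H′)) = H′`** (so `H′ ↦ Fix(H′)` is injective
on the subgroups of `H`, with left inverse `M ↦ G(M)`). [cite: GutierrezSevilla2008, §3 Thm 7 (iii)] -/
theorem fixingSubgroup_fixedField_of_le {H' : Subgroup (RatFunc K ≃ₐ[K] RatFunc K)} (hH' : H' ≤ H) :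
    (IntermediateField.fixedField H').fixingSubgroup = H' := by
  haveI : Finite H' := Finite.of_injective _ (Subgroup.inclusion_injective hH')
  exact fixingSubgroup_fixedField_of_finite H'

/-- **THEOREM 7 (iii), fields ↦ subgroups: every field `Fix(H) ≤ M ≤ K(u)` has `G(M) ≤ H` and `Fix(G(M)) = M`**
(`K(u)/M` is Galois as the top of the Galois tower `K(u)/Fix(H)`, so `[K(u) : M] = |G(M)| = [K(u) : Fix(G(M))]`).
[cite: GutierrezSevilla2008, §3 Thm 7 (iii)] -/
theorem fixedField_fixingSubgroup_of_le {M : IntermediateField K (RatFunc K)}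
    (hM : IntermediateField.fixedField H ≤ M) :
    M.fixingSubgroup ≤ H ∧ IntermediateField.fixedField M.fixingSubgroup = M := by
  have hGM : M.fixingSubgroup ≤ H := by
    have h := IntermediateField.fixingSubgroup_antitone hM
    rwa [fixingSubgroup_fixedField_of_finite H] at h
  refine ⟨hGM, ?_⟩
  haveI : Finite M.fixingSubgroup := Finite.of_injective _ (Subgroup.inclusion_injective hGM)
  haveI := finiteDimensional_fixedField_of_finite H
  haveI := isGalois_fixedField_of_finite H
  -- `K(u)/M` is finite Galois: `M` is an intermediate field of the Galois extension `K(u)/Fix(H)`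
  haveI hfdM : FiniteDimensional M (RatFunc K) :=
    inferInstanceAs (FiniteDimensional (IntermediateField.extendScalars hM) (RatFunc K))
  haveI hgalM : IsGalois M (RatFunc K) :=
    inferInstanceAs (IsGalois (IntermediateField.extendScalars hM) (RatFunc K))
  have hle : M ≤ IntermediateField.fixedField M.fixingSubgroup := (IntermediateField.le_iff_le _ _).mpr le_rfl
  refine (eq_of_le_of_finrank_eq' hle ?_).symm
  rw [finrank_fixedField_eq_card_of_finite, Nat.card_congr (fixingSubgroupEquiv M).toEquiv,
    IsGalois.card_aut_eq_finrank]

end Correspondence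


/-! ### §5. Theorem 8 and Corollary 1: the fixing group of an INDECOMPOSABLE `f` -/

section Indecomposable

variable {f : RatFunc K} (hf : ¬ ∃ c, f = RatFunc.C c)
  (hco : IsCoatom (IntermediateField.adjoin K ({f} : Set (RatFunc K))))
include hf hco

/-- **`f` indecomposable ⟹ `|G(f)| = 1` or `|G(f)| = deg f`**: `Fix(G(f))` lies between `K(f)` and `K(u)` and
`K(f)` is a coatom, so `Fix(G(f)) ∈ {K(u), K(f)}`, of codegree `1` resp. `deg f`. [cite: GutierrezSevilla2008, §3 Thm 8 (proof)] -/
theorem card_fixingSubgroup_adjoin_of_isCoatom :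
    Nat.card (IntermediateField.adjoin K ({f} : Set (RatFunc K))).fixingSubgroup = 1 ∨
      Nat.card (IntermediateField.adjoin K ({f} : Set (RatFunc K))).fixingSubgroup =
        max f.num.natDegree f.denom.natDegree := by
  haveI := finite_fixingSubgroup_adjoin hf
  have hle : IntermediateField.adjoin K ({f} : Set (RatFunc K)) ≤
      IntermediateField.fixedField (IntermediateField.adjoin K ({f} : Set (RatFunc K))).fixingSubgroup :=
    (IntermediateField.le_iff_le _ _).mpr le_rfl
  rcases hco.le_iff.mp hle with htop | heq
  · left
    rw [← finrank_fixedField_eq_card_of_finite, htop, IntermediateField.finrank_top]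
  · right
    rw [← finrank_fixedField_eq_card_of_finite, heq, RatFunc.finrank_eq_max_natDegree]

/-- **THEOREM 8 (ii): `f` indecomposable of COMPOSITE degree ⟹ `G(f)` is trivial** (if `|G(f)| = deg f`, Cauchy gives
`H′ ≤ G(f)` of prime order `p < deg f`, and `Fix(H′)`, of codegree `p`, would lie strictly between `K(f)` and `K(u)`:
«any generator of `Fix(H)` is a proper component of `f` on the right»). [cite: GutierrezSevilla2008, §3 Thm 8 (ii)] -/
theorem card_fixingSubgroup_adjoin_eq_one_of_isCoatom_of_not_prime
    (hnp : ¬ (max f.num.natDegree f.denom.natDegree).Prime) :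
    Nat.card (IntermediateField.adjoin K ({f} : Set (RatFunc K))).fixingSubgroup = 1 := by
  haveI := finite_fixingSubgroup_adjoin hf
  rcases card_fixingSubgroup_adjoin_of_isCoatom hf hco with h1 | hdeg
  · exact h1
  exfalso
  set G := (IntermediateField.adjoin K ({f} : Set (RatFunc K))).fixingSubgroup with hG
  set d := max f.num.natDegree f.denom.natDegree with hd
  have h2 : 2 ≤ d := ((isCoatom_adjoin_iff f hf).mp hco).1
  obtain ⟨p, hp, hpdvd⟩ := Nat.exists_prime_and_dvd (show d ≠ 1 by omega)
  have hplt : p < d := lt_of_le_of_ne (Nat.le_of_dvd (by omega) hpdvd) (fun h => hnp (h ▸ hp))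
  haveI := Fact.mk hp
  obtain ⟨g, hg⟩ := exists_prime_orderOf_dvd_card' (G := G) p (by rw [hdeg]; exact hpdvd)
  set H' := Subgroup.zpowers (g : RatFunc K ≃ₐ[K] RatFunc K) with hH'
  have hH'le : H' ≤ G := Subgroup.zpowers_le.mpr g.2
  haveI : Finite H' := Finite.of_injective _ (Subgroup.inclusion_injective hH'le)
  have hcard : Nat.card H' = p := by rw [hH', Nat.card_zpowers, Subgroup.orderOf_coe, hg]
  have hle' : IntermediateField.adjoin K ({f} : Set (RatFunc K)) ≤ IntermediateField.fixedField H' :=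
    (IntermediateField.le_iff_le _ _).mpr hH'le
  have hfin : Module.finrank (IntermediateField.fixedField H') (RatFunc K) = p := by
    rw [finrank_fixedField_eq_card_of_finite, hcard]
  rcases hco.le_iff.mp hle' with htop | heq
  · rw [htop, IntermediateField.finrank_top] at hfin
    exact hp.one_lt.ne hfin
  · rw [heq, RatFunc.finrank_eq_max_natDegree] at hfin
    omega

/-- **THEOREM 8 (i): `f` indecomposable of PRIME degree ⟹ `G(f)` is trivial or cyclic of order `deg f`.**
[cite: GutierrezSevilla2008, §3 Thm 8 (i)] -/
theorem isCyclic_fixingSubgroup_adjoin_of_isCoatom_of_prime (hp : (max f.num.natDegree f.denom.natDegree).Prime) :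
    Nat.card (IntermediateField.adjoin K ({f} : Set (RatFunc K))).fixingSubgroup = 1 ∨
      (Nat.card (IntermediateField.adjoin K ({f} : Set (RatFunc K))).fixingSubgroup =
          max f.num.natDegree f.denom.natDegree ∧
        IsCyclic (IntermediateField.adjoin K ({f} : Set (RatFunc K))).fixingSubgroup) := by
  rcases card_fixingSubgroup_adjoin_of_isCoatom hf hco with h1 | hdeg
  · exact Or.inl h1
  · haveI := Fact.mk hp
    exact Or.inr ⟨hdeg, isCyclic_of_prime_card hdeg⟩

end Indecomposable

/-- **COROLLARY 1: if `f` has composite degree and `G(f)` is not trivial, then `f` is decomposable** (`K(f)` is not a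
coatom). [cite: GutierrezSevilla2008, §3 Cor. 1] -/
theorem not_isCoatom_of_card_fixingSubgroup_ne_one {f : RatFunc K} (hf : ¬ ∃ c, f = RatFunc.C c)
    (hnp : ¬ (max f.num.natDegree f.denom.natDegree).Prime)
    (hG : Nat.card (IntermediateField.adjoin K ({f} : Set (RatFunc K))).fixingSubgroup ≠ 1) :
    ¬ IsCoatom (IntermediateField.adjoin K ({f} : Set (RatFunc K))) := fun hco =>
  hG (card_fixingSubgroup_adjoin_eq_one_of_isCoatom_of_not_prime hf hco hnp)


/-! ### §6. Remark 3: `Fix(Γ(K)) = K` iff `K` is infinite -/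

/-- Ring homomorphisms out of `K(u)` agree when they agree on the constants and on `u`.
[cite: GutierrezSevilla2008, §3 (the elements of Γ(K) are identified with the images of x)] -/
theorem ringHom_ratFunc_ext {L : Type*} [Semiring L] {φ ψ : RatFunc K →+* L}
    (hC : ∀ c, φ (RatFunc.C c) = ψ (RatFunc.C c)) (hX : φ RatFunc.X = ψ RatFunc.X) : φ = ψ := by
  apply IsLocalization.ringHom_ext (nonZeroDivisors K[X])
  refine Polynomial.ringHom_ext (fun c => ?_) ?_
  · simpa only [RingHom.comp_apply, RatFunc.algebraMap_C] using hC c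
  · simpa only [RingHom.comp_apply, RatFunc.algebraMap_X] using hX

/-- **«The elements of `Γ(K)` can be identified with the images of `x` under the automorphisms»**: two
`K`-automorphisms of `K(u)` with the same value at `u` are equal. [cite: GutierrezSevilla2008, §3] -/
theorem algEquiv_ext_of_apply_X_eq {σ τ : RatFunc K ≃ₐ[K] RatFunc K} (h : σ RatFunc.X = τ RatFunc.X) : σ = τ := by
  have key : ((σ : RatFunc K →ₐ[K] RatFunc K) : RatFunc K →+* RatFunc K) =
      ((τ : RatFunc K →ₐ[K] RatFunc K) : RatFunc K →+* RatFunc K) :=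
    ringHom_ratFunc_ext (fun c => by
      rw [AlgHom.coe_toRingHom, AlgHom.coe_toRingHom, ← RatFunc.algebraMap_eq_C, AlgHom.commutes, AlgHom.commutes])
      (by rw [AlgHom.coe_toRingHom, AlgHom.coe_toRingHom]; exact h)
  have key' : (σ : RatFunc K →ₐ[K] RatFunc K) = (τ : RatFunc K →ₐ[K] RatFunc K) := AlgHom.coe_ringHom_injective key
  exact AlgEquiv.ext fun x => DFunLike.congr_fun key' x

/-- The map `σ ↦ σ(u)` is injective on `Γ(K)`. [cite: GutierrezSevilla2008, §3] -/
theorem injective_algEquiv_apply_X :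
    Function.Injective fun σ : RatFunc K ≃ₐ[K] RatFunc K => σ RatFunc.X := fun _ _ h =>
  algEquiv_ext_of_apply_X_eq h

/-- The translation `u ↦ u + b` is surjective (a unit of `K(u)`). [cite: GutierrezSevilla2008, §3 (units = Möbius transformations)] -/
theorem ratFuncSubst_X_add_C_surjective (b : K) :
    Function.Surjective (ratFuncSubst (RatFunc.X + RatFunc.C b) (X_add_C_ne_C b)) := by
  rw [ratFuncSubst_surjective_iff]
  have h : (RatFunc.X + RatFunc.C b : RatFunc K) = algebraMap K[X] (RatFunc K) (Polynomial.X + Polynomial.C b) := by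
    rw [map_add, RatFunc.algebraMap_X, RatFunc.algebraMap_C]
  rw [h, RatFunc.num_algebraMap, RatFunc.denom_algebraMap, natDegree_X_add_C, natDegree_one, Nat.max_eq_left zero_le_one]

/-- **The translations `u ↦ u + b`, `b ∈ K`, form a copy of `K` inside `Γ(K)`**: an injection `K ↪ Aut_K K(u)`
(«for each non-constant function `f` there exists a unit `x + b` with `b ∈ K` which does not leave it fixed» uses that
there are infinitely many of them when `K` is infinite). [cite: GutierrezSevilla2008, §3 Remark 3] -/
theorem exists_injective_translation :
    ∃ T : K → (RatFunc K ≃ₐ[K] RatFunc K), Function.Injective T ∧ ∀ b, T b RatFunc.X = RatFunc.X + RatFunc.C b := by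
  refine ⟨fun b => AlgEquiv.ofBijective (ratFuncSubst (RatFunc.X + RatFunc.C b) (X_add_C_ne_C b))
    ⟨ratFuncSubst_injective _ _, ratFuncSubst_X_add_C_surjective b⟩, ?_, fun b => ?_⟩
  · intro b b' h
    have h' := congrArg (fun σ : RatFunc K ≃ₐ[K] RatFunc K => σ RatFunc.X) h
    simp only [AlgEquiv.ofBijective_apply, ratFuncSubst_X, add_right_inj] at h'
    exact RatFunc.C_injective h'
  · rw [AlgEquiv.ofBijective_apply, ratFuncSubst_X]

/-- `Γ(K)` is infinite when `K` is. [cite: GutierrezSevilla2008, §3 Remark 3] -/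
theorem infinite_algEquiv_of_infinite [Infinite K] : Infinite (RatFunc K ≃ₐ[K] RatFunc K) := by
  obtain ⟨T, hT, -⟩ := exists_injective_translation (K := K)
  exact Infinite.of_injective T hT

/-- **REMARK 3, `⟸`: if `K` is infinite, the only rational functions fixed by all of `Γ(K)` are the constants**
(`Fix(Γ) = K`: Theorem 6 (i) applied to the infinite group `Γ`). [cite: GutierrezSevilla2008, §3 Remark 3] -/
theorem fixedField_top_eq_bot_of_infinite [Infinite K] :
    IntermediateField.fixedField (⊤ : Subgroup (RatFunc K ≃ₐ[K] RatFunc K)) = ⊥ := by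
  refine fixedField_eq_bot_of_infinite ⊤ fun hfin => ?_
  haveI := infinite_algEquiv_of_infinite (K := K)
  haveI : Finite (RatFunc K ≃ₐ[K] RatFunc K) := Finite.of_equiv _ Subgroup.topEquiv.toEquiv
  exact not_finite (RatFunc K ≃ₐ[K] RatFunc K)

/-- **`Γ(K)` is finite when `K` is**: `σ ↦ σ(u)` is injective with values among the Möbius functions
`(αu + β)/(γu + δ)`, `α, β, γ, δ ∈ K`. [cite: GutierrezSevilla2008, §3 Remark 3] -/
theorem finite_algEquiv_of_finite [Finite K] : Finite (RatFunc K ≃ₐ[K] RatFunc K) := by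
  let M : K × K × K × K → RatFunc K := fun c =>
    algebraMap K[X] (RatFunc K) (Polynomial.C c.1 * Polynomial.X + Polynomial.C c.2.1) /
      algebraMap K[X] (RatFunc K) (Polynomial.C c.2.2.1 * Polynomial.X + Polynomial.C c.2.2.2)
  have hrange : ∀ σ : RatFunc K ≃ₐ[K] RatFunc K, σ RatFunc.X ∈ Set.range M := fun σ => by
    obtain ⟨α, β, γ, δ, -, h⟩ := exists_moebius_of_max_natDegree_eq_one (σ RatFunc.X)
      (max_natDegree_eq_one_of_surjective (σ : RatFunc K →ₐ[K] RatFunc K) σ.surjective)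
    exact ⟨(α, β, γ, δ), h.symm⟩
  haveI : Finite (Set.range M) := (Set.finite_range M).to_subtype
  refine Finite.of_injective (fun σ => (⟨σ RatFunc.X, hrange σ⟩ : Set.range M)) fun σ τ h => ?_
  exact algEquiv_ext_of_apply_X_eq (congrArg Subtype.val h)

/-- **REMARK 3, `⟹`: if `K` is finite then `Γ(K)` is finite and `Fix(Γ) = K(f) ⊋ K` with `deg f = |Γ(K)|`** (Theorem
6 (ii) for `H = Γ`). [cite: GutierrezSevilla2008, §3 Remark 3, Thm 6 (ii)] -/
theorem fixedField_top_ne_bot_of_finite [Finite K] :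
    IntermediateField.fixedField (⊤ : Subgroup (RatFunc K ≃ₐ[K] RatFunc K)) ≠ ⊥ ∧
      ∃ f : RatFunc K, (¬ ∃ c, f = RatFunc.C c) ∧
        IntermediateField.fixedField (⊤ : Subgroup (RatFunc K ≃ₐ[K] RatFunc K)) =
          IntermediateField.adjoin K ({f} : Set (RatFunc K)) ∧
        max f.num.natDegree f.denom.natDegree = Nat.card (RatFunc K ≃ₐ[K] RatFunc K) := by
  haveI := finite_algEquiv_of_finite (K := K)
  refine ⟨fixedField_ne_bot_of_finite ⊤, ?_⟩
  obtain ⟨f, hf, hFix, hdeg⟩ := exists_fixedField_eq_adjoin (⊤ : Subgroup (RatFunc K ≃ₐ[K] RatFunc K))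
  refine ⟨f, hf, hFix, ?_⟩
  rw [hdeg, Nat.card_congr Subgroup.topEquiv.toEquiv]

/-- **REMARK 3: `Fix(Γ(K)) = K` iff `K` is infinite.** [cite: GutierrezSevilla2008, §3 Remark 3] -/
theorem fixedField_top_eq_bot_iff_infinite :
    IntermediateField.fixedField (⊤ : Subgroup (RatFunc K ≃ₐ[K] RatFunc K)) = ⊥ ↔ Infinite K := by
  constructor
  · intro h
    by_contra hK
    haveI : Finite K := not_infinite_iff_finite.mp hK
    exact (fixedField_top_ne_bot_of_finite (K := K)).1 h
  · intro hK
    exact fixedField_top_eq_bot_of_infinite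

end Literature.FieldTheory.FunctionField
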